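import Literature.Geometry.Symplectic.SphereIntersectionIndexHomologicalNoncompact

/-!
# The signed crossing count of a sphere homotopic to a sphere missing the surface vanishes
(registered helper `helper_homologicalCount` of the stub `stub_normalWitnessTransfer`, line
`cross-cap-laurent`, crux `GromovRecognitionRelEnd`, item stmt-SmoothPoincare4-11009)

Setting: `X` a Hausdorff second countable smooth `4`-manifold, `U ⊆ X` open, `g : X → ℂ` smooth
on `U`, `s : ℂ` with CLOSED fibre `K_s = {y ∈ U | g y = s}`; two smooth two-chart spheres
`(u, v, F)` and `(u₀, v₀, F₀)` (`v w = u w⁻¹` off the origin, `F : ℂℙ¹ → X` the glued map, equal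
to `u`, resp. `v`, in the two affine coordinates), with `F` homotopic to `F₀`, such that the
sphere `(u₀, v₀)` misses `K_s` entirely, while `(u, v)` meets it at finitely many `u`-parameters
and not at the point at infinity `v 0`.  Claim (`helper_homologicalCount`): for all small radii
`r`, the sum over the crossing parameters `z` of the winding numbers of
`t ↦ g (u (z + r e^{2πit})) - s` is zero.

Proof (G. E. Bredon, *Topology and Geometry*, GTM 139 (1993), VI.11 Thm. 11.9 and p. 375,
IV.7 Cor. 7.5: intersection numbers with a closed co-oriented surface factor through `H₂`).
By `Literature.Geometry.Symplectic.sphere_zeroSetIndex_factorsThroughHomology_of_isClosed`,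
applied to `π = g - s` on `U` (whose zero set is the closed `K_s`), there is an additive
`c : H₂(X; ℤ) → ℤ` whose value on the pushed-forward fundamental class `F_*[ℂℙ¹]` of any smooth
two-chart sphere meeting `K_s` at finitely many parameters is, for all small radii, the sum of
the winding numbers about the `u`-crossings plus that about `w = 0` if `v 0 ∈ K_s`.  For
`(u₀, v₀, F₀)` both index sets are empty, so `c (F₀_*[ℂℙ¹]) = 0`; homotopy invariance of
singular homology (`singularHomology.map_eq_of_homotopic`) gives `F_*[ℂℙ¹] = F₀_*[ℂℙ¹]`, so
`c (F_*[ℂℙ¹]) = 0`; and for `(u, v, F)` the `v`-term is an empty sum (`v 0 ∉ K_s`), whence the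
sum over the `u`-crossings vanishes for all radii below the radius provided by the fact.
No new definitions.
-/

noncomputable section

open scoped Manifold ContDiff Topology
open Set Function
open Literature.Topology.FourManifolds Literature.Topology.FourManifolds.ComplexProjectiveSpace
  Literature.AlgebraicTopology.SingularHomology Literature.Topology.PlaneTopology
  Literature.Geometry.Symplectic

-- the prescribed namespace `Summit.<P>.<Sub>.…` duplicates `SmoothPoincare4` (P = Sub)
set_option linter.dupNamespace false

namespace Summit.SmoothPoincare4.SmoothPoincare4.Theorems.GromovRecognitionRelEnd.CrossCapLaurent

namespace HelperHomologicalCount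

/-- The crossing-parameter set of `π = g - s` is that of the fibre `g = s`. [folklore] -/
theorem setOf_sub_eq_zero_eq {X : Type*} (U : Set X) (g : X → ℂ) (w : ℂ → X) (s : ℂ) :
    {z : ℂ | w z ∈ U ∧ g (w z) - s = 0} = {z : ℂ | w z ∈ U ∧ g (w z) = s} := by
  ext z
  simp only [mem_setOf_eq, sub_eq_zero]

/-- If a chart misses the fibre `g = s` over `U`, its crossing-parameter set for `π = g - s` is
empty. [folklore] -/
theorem setOf_sub_eq_zero_eq_empty {X : Type*} (U : Set X) (g : X → ℂ) (w : ℂ → X) (s : ℂ)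
    (h : ∀ z : ℂ, w z ∈ U → g (w z) ≠ s) :
    {z : ℂ | w z ∈ U ∧ g (w z) - s = 0} = ∅ := by
  ext z
  simp only [mem_setOf_eq, sub_eq_zero, mem_empty_iff_false, iff_false, not_and]
  exact h z

/-- If the point at infinity `v 0` of the `u`-chart is not on the fibre `g = s` over `U`, the
crossing-parameter set `{w | w = 0 ∧ v w ∈ U ∧ g (v w) - s = 0}` at infinity is empty.
[folklore] -/
theorem setOf_infty_eq_empty {X : Type*} (U : Set X) (g : X → ℂ) (v : ℂ → X) (s : ℂ)
    (h : ¬ (v 0 ∈ U ∧ g (v 0) = s)) :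
    {w : ℂ | w = 0 ∧ v w ∈ U ∧ g (v w) - s = 0} = ∅ := by
  ext w
  simp only [mem_setOf_eq, sub_eq_zero, mem_empty_iff_false, iff_false, not_and]
  rintro rfl hU hs
  exact h ⟨hU, hs⟩

end HelperHomologicalCount

open HelperHomologicalCount in
/-- **The signed crossing count of a sphere with a closed fibre vanishes when the sphere is
homotopic to one missing the fibre.** For a Hausdorff second countable smooth `4`-manifold `X`,
`U ⊆ X` open, `g : X → ℂ` smooth on `U` with closed fibre `{y ∈ U | g y = s}`, and two smooth
two-chart spheres `(u, v, F)`, `(u₀, v₀, F₀)` with `F` homotopic to `F₀`, `(u₀, v₀)` missing the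
fibre, `(u, v)` meeting it at finitely many `u`-parameters and not at `v 0`: for all small
radii `r`, `∑ᶠ` over the crossing parameters `z` of the winding numbers of
`t ↦ g (u (circleLoop z r t)) - s` is `0`.  The counts are the values of an additive functional
on `H₂(X; ℤ)` at `F_*[ℂℙ¹] = F₀_*[ℂℙ¹]` (homotopy invariance), and the value at `F₀_*[ℂℙ¹]`
is an empty sum. [cite: Bredon1993, VI.11 Thm. 11.9 and p. 375; IV.7 Cor. 7.5] -/
theorem helper_homologicalCount : ∀ (X : Type) [TopologicalSpace X] [T2Space X] [SecondCountableTopology X] [ChartedSpace (EuclideanSpace ℝ (Fin 4)) X] [IsManifold (𝓡 4) ∞ X] (U : Set X) (g : X → ℂ) (u v u₀ v₀ : ℂ → X) (F F₀ : C(Literature.Topology.FourManifolds.ComplexProjectiveSpace 1, X)) (s : ℂ), IsOpen U → ContMDiffOn (𝓡 4) 𝓘(ℝ, ℂ) ∞ g U → IsClosed {y | y ∈ U ∧ g y = s} → ContMDiff 𝓘(ℝ, ℂ) (𝓡 4) ∞ u → ContMDiff 𝓘(ℝ, ℂ) (𝓡 4) ∞ v → (∀ z : ℂ, z ≠ 0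 → v z = u z⁻¹) → (∀ p, Literature.Topology.FourManifolds.ComplexProjectiveSpace.CoordNeZero 0 p → F p = u (Literature.Topology.FourManifolds.ComplexProjectiveSpace.affineCoordComplex 0 p 0)) → (∀ p, Literature.Topology.FourManifolds.ComplexProjectiveSpace.CoordNeZero 1 p → F p = v (Literature.Topology.FourManifolds.ComplexProjectiveSpace.affineCoordComplex 1 p 0)) → ContMDiff 𝓘(ℝ, ℂ) (𝓡 4) ∞ u₀ → ContMDiff 𝓘(ℝ, ℂ) (𝓡 4) ∞ v₀ → (∀ z : ℂ, z ≠ 0 → v₀ z = u₀ z⁻¹) → (∀ p, Literature.Topology.FourManifolds.ComplexProjectiveSpace.CoordNeZero 0 p → F₀ p = u₀ (Literature.Topology.FourManifolds.ComplexProjectiveSpace.affineCoordComplex 0 p 0)) → (∀ p, Literature.Topology.FourManifolds.ComplexProjectiveSpace.CoordNeZero 1 p → F₀ p = v₀ (Literature.Topology.FourManifolds.ComplexProjectiveSpace.affineCoordComplex 1 p 0)) → (∀ z : ℂ, u₀ z ∈ U → g (u₀ z) ≠ s) → (v₀ 0 ∈ U → g (v₀ 0) ≠ s) → F.Homotopic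 F₀ → {z : ℂ | u z ∈ U ∧ g (u z) = s}.Finite → ¬ (v 0 ∈ U ∧ g (v 0) = s) → ∃ r₀ : ℝ, 0 < r₀ ∧ ∀ r : ℝ, 0 < r → r ≤ r₀ → ∑ᶠ z ∈ {z : ℂ | u z ∈ U ∧ g (u z) = s}, Literature.Topology.PlaneTopology.wind (fun t => g (u (Literature.Topology.PlaneTopology.circleLoop z r t)) - s) = 0 := by
  intro X _ _ _ _ _ U g u v u₀ v₀ F F₀ s hU hg hKc hu hv huv hF0 hF1 hu₀ hv₀ huv₀ hF₀0 hF₀1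
    hmiss hmiss0 hhom hfin hv0
  -- the normal coordinate `π = g - s` on `U`, with closed zero set `{g = s}`
  have hπ : ContMDiffOn (𝓡 4) 𝓘(ℝ, ℂ) ∞ (fun y => g y - s) U := hg.sub contMDiffOn_const
  have hKc' : IsClosed {y : X | y ∈ U ∧ (fun y => g y - s) y = 0} := by
    have e : {y : X | y ∈ U ∧ (fun y => g y - s) y = 0} = {y | y ∈ U ∧ g y = s} := by
      ext y
      simp only [mem_setOf_eq, sub_eq_zero]
    rw [e]
    exact hKc
  -- the homological functional
  obtain ⟨c, hc⟩ :=
    sphere_zeroSetIndex_factorsThroughHomology_of_isClosed X (fun y => g y - s) U hU hπ hKc'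
  -- (1) the sphere `(u₀, v₀, F₀)` misses the zero set: `c (F₀_*[ℂℙ¹]) = 0`
  have hZ₀ : {z : ℂ | u₀ z ∈ U ∧ g (u₀ z) - s = 0} = ∅ := setOf_sub_eq_zero_eq_empty U g u₀ s hmiss
  have hZi₀ : {w : ℂ | w = 0 ∧ v₀ w ∈ U ∧ g (v₀ w) - s = 0} = ∅ :=
    setOf_infty_eq_empty U g v₀ s fun h => hmiss0 h.1 h.2
  have hfin₀ : {z : ℂ | u₀ z ∈ U ∧ g (u₀ z) - s = 0}.Finite := by
    rw [hZ₀]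
    exact finite_empty
  obtain ⟨r₁, hr₁, H₁⟩ := hc u₀ v₀ F₀ hu₀ hv₀ huv₀ hF₀0 hF₀1 hfin₀
  have hc₀ : c (singularHomology.map ℤ ℤ F₀ (2 * 1)
      (ComplexProjectiveSpace.homologicalOrientationInt 1).fundamentalClass) = 0 := by
    have h := H₁ r₁ hr₁ le_rfl
    have e₁ : (∑ᶠ z ∈ {z : ℂ | u₀ z ∈ U ∧ g (u₀ z) - s = 0},
        wind (fun t => g (u₀ (circleLoop z r₁ t)) - s)) = 0 := by
      rw [hZ₀]
      exact finsum_mem_empty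
    have e₂ : (∑ᶠ w ∈ {w : ℂ | w = 0 ∧ v₀ w ∈ U ∧ g (v₀ w) - s = 0},
        wind (fun t => g (v₀ (circleLoop w r₁ t)) - s)) = 0 := by
      rw [hZi₀]
      exact finsum_mem_empty
    rw [h]
    exact (congrArg₂ (· + ·) e₁ e₂).trans (add_zero 0)
  -- (2) homotopy invariance: `F_*[ℂℙ¹] = F₀_*[ℂℙ¹]`
  have hmap : singularHomology.map ℤ ℤ F (2 * 1) = singularHomology.map ℤ ℤ F₀ (2 * 1) :=
    singularHomology.map_eq_of_homotopic ℤ ℤ hhom (2 * 1)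
  -- (3) the sphere `(u, v, F)`: finite crossing set, no crossing at infinity
  have hZ : {z : ℂ | u z ∈ U ∧ g (u z) = s} = {z : ℂ | u z ∈ U ∧ g (u z) - s = 0} :=
    (setOf_sub_eq_zero_eq U g u s).symm
  have hZi : {w : ℂ | w = 0 ∧ v w ∈ U ∧ g (v w) - s = 0} = ∅ := setOf_infty_eq_empty U g v s hv0
  have hfin' : {z : ℂ | u z ∈ U ∧ g (u z) - s = 0}.Finite := hZ ▸ hfin
  obtain ⟨r₂, hr₂, H₂⟩ := hc u v F hu hv huv hF0 hF1 hfin'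
  refine ⟨r₂, hr₂, fun r hr hrr => ?_⟩
  have e₂ : (∑ᶠ w ∈ {w : ℂ | w = 0 ∧ v w ∈ U ∧ g (v w) - s = 0},
      wind (fun t => g (v (circleLoop w r t)) - s)) = 0 := by
    rw [hZi]
    exact finsum_mem_empty
  rw [hZ]
  calc (∑ᶠ z ∈ {z : ℂ | u z ∈ U ∧ g (u z) - s = 0}, wind (fun t => g (u (circleLoop z r t)) - s))
      = (∑ᶠ z ∈ {z : ℂ | u z ∈ U ∧ g (u z) - s = 0}, wind (fun t => g (u (circleLoop z r t)) - s)) +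
          (∑ᶠ w ∈ {w : ℂ | w = 0 ∧ v w ∈ U ∧ g (v w) - s = 0},
            wind (fun t => g (v (circleLoop w r t)) - s)) := by rw [e₂, add_zero]
    _ = c (singularHomology.map ℤ ℤ F (2 * 1)
          (ComplexProjectiveSpace.homologicalOrientationInt 1).fundamentalClass) :=
        (H₂ r hr hrr).symm
    _ = c (singularHomology.map ℤ ℤ F₀ (2 * 1)
          (ComplexProjectiveSpace.homologicalOrientationInt 1).fundamentalClass) := by rw [hmap]
    _ = 0 := hc₀

end Summit.SmoothPoincare4.SmoothPoincare4.Theorems.GromovRecognitionRelEnd.CrossCapLaurent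

end
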